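import Summits.QuantumFields.QCD.Theses.PauliWegnerSea
import Literature.MathematicalPhysics.QuantumFieldTheory.StrongCouplingActivities
import Literature.MathematicalPhysics.QuantumFieldTheory.QCDPhaseQuenched

/-!
# Crux `TiltedFlatness` (stmt-QuantumFields-14070), line `circle-transport` — stub `stub_torusSmallBalls`

Small balls on the flat torus for separately band-limited functions.

Let `q ≥ 0` be a continuous function on `ℝ^m` which, in each coordinate separately (all the
other coordinates frozen), is a trigonometric polynomial of degree `≤ D`.  Assuming the two
one-dimensional facts

* (N)  Nikolskii's inequality `f t ≤ (2D+1) · (mean of f over [-π, π])` for non-negative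
  trigonometric polynomials `f` of degree `≤ D`, and
* (SB) the one-dimensional small-ball estimate
  `|{t ∈ [-π, π] : f t ≤ ε · mean f}| ≤ C₁ ε ^ c₁` for such `f` with positive mean,

we prove that for every reference value `q θ₀ > 0` and every `η > 0` the sub-level set
`{θ ∈ [-π, π]^m : q θ ≤ η · q θ₀}` has Lebesgue measure `≤ C η ^ c`, with `C, c > 0` depending on
`(m, D)` only (theorem `stub_torusSmallBalls`).

Proof: slice induction on `m` (for `η ≤ 1`; for `η > 1` the trivial bound `(2π)^m` suffices).
For `m = 0` the function is constant and the set is empty when `η < 1`.  For the step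
`m → m + 1` split `θ = (t, θ')` along one coordinate `i` (the measure-preserving equivalence
`MeasurableEquiv.piFinSuccAbove`), put `r = √η` and let `R θ' := q (i.insertNth (θ₀ i) θ')` be
the frozen slice through `θ₀`, so `R (i.removeNth θ₀) = q θ₀`.  The sub-level set is covered by
`[-π, π] × {R ≤ r · q θ₀}`, of measure `≤ 2π · C_m r ^ {c_m}` by the induction hypothesis applied
to `R`, and by the set where `R θ' > r · q θ₀` but `q (t, θ') ≤ η · q θ₀`; on each `t`-fibre of
the latter, Nikolskii (N) for `t ↦ q (t, θ')` gives `r · q θ₀ < R θ' ≤ (2D+1) · mean`, hence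
`q (t, θ') ≤ η q θ₀ < (2D+1) r · mean`, and (SB) bounds the fibre by `C₁ ((2D+1) r) ^ {c₁}`;
integrating over `θ' ∈ [-π, π]^m` (Tonelli, `Measure.prod_apply_symm`) gives
`(2π)^m C₁ ((2D+1) r) ^ {c₁}`.  With `c_{m+1} = min c_m c₁ / 2` both terms are `O(η ^ {c_{m+1}})`
for `η ≤ 1`.

Sources: folklore slice argument for sub-level sets of functions that are polynomial-like in
each variable separately; cf. A. Carbery, J. Wright, *Distributional and `L^q` norm
inequalities for polynomials over convex bodies in `ℝ^n`*, Math. Res. Lett. 8 (2001) 233–248.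
-/

noncomputable section

namespace Summit.QuantumFields.QCD.Theorems.CircleTransport

open scoped BigOperators Real Matrix.Norms.L2Operator ENNReal
open MeasureTheory Set Filter
open Literature.MathematicalPhysics.QuantumFieldTheory Literature.MathematicalPhysics.QuantumLattice
  Literature.Probability.LatticeModels

/-- `SU(3)` (the tree's `Matrix.specialUnitaryGroup (Fin 3) ℂ`). -/
local notation "SU3" => Matrix.specialUnitaryGroup (Fin 3) ℂ

/-- STUB 5 (TSB, size L): small balls on the flat torus for separately band-limited continuous `q ≥ 0`,
from Nikolskii + the 1-D engine by slice induction. -/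
theorem stub_torusSmallBalls :
    (∀ (D : ℕ) (f : ℝ → ℝ),
      (∃ a : ℤ → ℂ, ∀ t : ℝ, ((f t : ℝ) : ℂ) =
        ∑ k ∈ Finset.Icc (-(D : ℤ)) D, a k * Complex.exp ((k : ℂ) * (t : ℂ) * Complex.I)) →
      (∀ t, 0 ≤ f t) → ∀ t : ℝ, f t ≤ (2 * D + 1) * ((∫ s in Set.Icc (-π) π, f s) / (2 * π))) →
    (∀ D : ℕ, ∃ C c : ℝ, 0 < C ∧ 0 < c ∧ ∀ f : ℝ → ℝ,
      (∃ a : ℤ → ℂ, ∀ t : ℝ, ((f t : ℝ) : ℂ) =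
        ∑ k ∈ Finset.Icc (-(D : ℤ)) D, a k * Complex.exp ((k : ℂ) * (t : ℂ) * Complex.I)) →
      (∀ t, 0 ≤ f t) → 0 < ∫ t in Set.Icc (-π) π, f t → ∀ ε : ℝ, 0 < ε →
        volume {t ∈ Set.Icc (-π) π | f t ≤ ε * ((∫ s in Set.Icc (-π) π, f s) / (2 * π))} ≤
          ENNReal.ofReal (C * ε ^ c)) →
    ∀ (m D : ℕ), ∃ C c : ℝ, 0 < C ∧ 0 < c ∧ ∀ q : (Fin m → ℝ) → ℝ, Continuous q → (∀ θ, 0 ≤ q θ) →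
      (∀ (θ : Fin m → ℝ) (j : Fin m), ∃ a : ℤ → ℂ, ∀ t : ℝ, ((q (Function.update θ j t) : ℝ) : ℂ) =
        ∑ k ∈ Finset.Icc (-(D : ℤ)) D, a k * Complex.exp ((k : ℂ) * (t : ℂ) * Complex.I)) →
      ∀ θ₀ : Fin m → ℝ, 0 < q θ₀ → ∀ η : ℝ, 0 < η →
        (volume {θ ∈ Set.Icc (fun _ : Fin m => -π) (fun _ => π) | q θ ≤ η * q θ₀}).toReal ≤ C * η ^ c := by
  intro hN hSB m D
  obtain ⟨C₁, c₁, hC₁, hc₁, hSB₁⟩ := hSB D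
  -- the volume of the box `[-π, π]^n`
  have hbox : ∀ n : ℕ,
      volume (Icc (fun _ : Fin n => -π) (fun _ => π)) = ENNReal.ofReal (2 * π) ^ n := by
    intro n
    simp only [Real.volume_Icc_pi, Finset.prod_const, Finset.card_univ, Fintype.card_fin,
      sub_neg_eq_add, ← two_mul]
  have hbox_ne : ∀ n : ℕ, volume (Icc (fun _ : Fin n => -π) (fun _ => π)) ≠ ∞ := fun n => by
    rw [hbox]; exact ENNReal.pow_ne_top ENNReal.ofReal_ne_top
  -- the main claim, for `η ≤ 1`, by slice induction on the dimension
  have hmain : ∀ n : ℕ, ∃ C c : ℝ, 0 < C ∧ 0 < c ∧ ∀ q : (Fin n → ℝ) → ℝ, Continuous q →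
      (∀ θ, 0 ≤ q θ) →
      (∀ (θ : Fin n → ℝ) (j : Fin n), ∃ a : ℤ → ℂ, ∀ t : ℝ,
        ((q (Function.update θ j t) : ℝ) : ℂ) =
          ∑ k ∈ Finset.Icc (-(D : ℤ)) D, a k * Complex.exp ((k : ℂ) * (t : ℂ) * Complex.I)) →
      ∀ θ₀ : Fin n → ℝ, 0 < q θ₀ → ∀ η : ℝ, 0 < η → η ≤ 1 →
        (volume {θ ∈ Icc (fun _ : Fin n => -π) (fun _ => π) | q θ ≤ η * q θ₀}).toReal ≤
          C * η ^ c := by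
    intro n
    induction n with
    | zero =>
      refine ⟨1, 1, one_pos, one_pos, ?_⟩
      intro q _hq _hq0 _hband θ₀ hqθ₀ η hη hη1
      rcases hη1.lt_or_eq with hlt | rfl
      · -- `q` is constant, so the set is empty
        have hempty : {θ ∈ Icc (fun _ : Fin 0 => -π) (fun _ => π) | q θ ≤ η * q θ₀} ⊆ ∅ := by
          rintro θ ⟨-, hθ⟩
          rw [Subsingleton.elim θ θ₀] at hθ
          nlinarith
        have h0 : volume {θ ∈ Icc (fun _ : Fin 0 => -π) (fun _ => π) | q θ ≤ η * q θ₀} = 0 :=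
          measure_mono_null hempty measure_empty
        rw [h0, ENNReal.toReal_zero]
        positivity
      · calc (volume {θ ∈ Icc (fun _ : Fin 0 => -π) (fun _ => π) | q θ ≤ 1 * q θ₀}).toReal
            ≤ (volume (Icc (fun _ : Fin 0 => -π) (fun _ => π))).toReal :=
              ENNReal.toReal_mono (hbox_ne 0) (measure_mono fun θ hθ => hθ.1)
          _ = 1 * (1 : ℝ) ^ (1 : ℝ) := by rw [hbox 0, pow_zero, ENNReal.toReal_one]; norm_num
    | succ m ih =>
      obtain ⟨Cm, cm, hCm, hcm, ihm⟩ := ih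
      refine ⟨2 * π * Cm + C₁ * (2 * D + 1) ^ c₁ * (2 * π) ^ m, min cm c₁ / 2, by positivity,
        by positivity, ?_⟩
      intro q hq hq0 hband θ₀ hqθ₀ η hη hη1
      obtain ⟨i⟩ : Nonempty (Fin (m + 1)) := ⟨0⟩
      -- `r = √η`
      obtain ⟨r, hr_def⟩ : ∃ r : ℝ, r = Real.sqrt η := ⟨_, rfl⟩
      have hr0 : 0 < r := by rw [hr_def]; exact Real.sqrt_pos.2 hη
      have hrr : r * r = η := by rw [hr_def]; exact Real.mul_self_sqrt hη.le
      have hpow : ∀ c' : ℝ, min cm c₁ ≤ c' → r ^ c' ≤ η ^ (min cm c₁ / 2) := by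
        intro c' hc'
        rw [hr_def, Real.sqrt_eq_rpow, ← Real.rpow_mul hη.le]
        exact Real.rpow_le_rpow_of_exponent_ge hη hη1 (by linarith)
      have hr1 : r ≤ 1 := by rw [hr_def]; exact Real.sqrt_le_one.2 hη1
      -- the frozen slice `R θ' := q (i.insertNth (θ₀ i) θ')` through `θ₀`
      have hRθ₀ : q (i.insertNth (θ₀ i) (i.removeNth θ₀)) = q θ₀ := by
        rw [Fin.insertNth_self_removeNth]
      have hRcont : Continuous fun θ' : Fin m → ℝ => q (i.insertNth (θ₀ i) θ') :=
        hq.comp (Continuous.finInsertNth i continuous_const continuous_id)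
      have hRband : ∀ (θ' : Fin m → ℝ) (j : Fin m), ∃ a : ℤ → ℂ, ∀ t : ℝ,
          ((q (i.insertNth (θ₀ i) (Function.update θ' j t)) : ℝ) : ℂ) =
            ∑ k ∈ Finset.Icc (-(D : ℤ)) D, a k * Complex.exp ((k : ℂ) * (t : ℂ) * Complex.I) := by
        intro θ' j
        obtain ⟨a, ha⟩ := hband (i.insertNth (θ₀ i) θ') (i.succAbove j)
        exact ⟨a, fun t => by rw [Fin.insertNth_update]; exact ha t⟩
      -- the induction hypothesis for the frozen slice, at level `r`
      have hIH : (volume {θ' ∈ Icc (fun _ : Fin m => -π) (fun _ => π) |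
          q (i.insertNth (θ₀ i) θ') ≤ r * q θ₀}).toReal ≤ Cm * r ^ cm := by
        have h := ihm (fun θ' => q (i.insertNth (θ₀ i) θ')) hRcont (fun _ => hq0 _) hRband
          (i.removeNth θ₀) (by rw [hRθ₀]; exact hqθ₀) r hr0 hr1
        simp only [hRθ₀] at h
        exact h
      -- the sets
      set A : Set (Fin (m + 1) → ℝ) :=
        {θ ∈ Icc (fun _ : Fin (m + 1) => -π) (fun _ => π) | q θ ≤ η * q θ₀}
      set S : Set (Fin m → ℝ) :=
        {θ' ∈ Icc (fun _ : Fin m => -π) (fun _ => π) | q (i.insertNth (θ₀ i) θ') ≤ r * q θ₀}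
      set B : Set (ℝ × (Fin m → ℝ)) :=
        {p | p.1 ∈ Icc (-π) π ∧ p.2 ∈ Icc (fun _ : Fin m => -π) (fun _ => π) ∧
          r * q θ₀ < q (i.insertNth (θ₀ i) p.2) ∧ q (i.insertNth p.1 p.2) ≤ η * q θ₀}
      set K : ℝ≥0∞ := ENNReal.ofReal (C₁ * ((2 * D + 1) * r) ^ c₁)
      -- splitting the sub-level set
      have hsub : (MeasurableEquiv.piFinSuccAbove (fun _ : Fin (m + 1) => ℝ) i).symm ⁻¹' A ⊆
          Icc (-π) π ×ˢ S ∪ B := by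
        rintro ⟨t, θ'⟩ hp
        have hp' : i.insertNth t θ' ∈ Icc (fun _ : Fin (m + 1) => -π) (fun _ => π) ∧
            q (i.insertNth t θ') ≤ η * q θ₀ := hp
        obtain ⟨hmem, hle⟩ := hp'
        have ht : t ∈ Icc (-π) π := ⟨by simpa using hmem.1 i, by simpa using hmem.2 i⟩
        have hθ' : θ' ∈ Icc (fun _ : Fin m => -π) (fun _ => π) :=
          ⟨fun j => by simpa using hmem.1 (i.succAbove j),
            fun j => by simpa using hmem.2 (i.succAbove j)⟩
        by_cases hR : q (i.insertNth (θ₀ i) θ') ≤ r * q θ₀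
        · exact Or.inl ⟨ht, hθ', hR⟩
        · exact Or.inr ⟨ht, hθ', not_le.mp hR, hle⟩
      -- (i) the product part
      have hSfin : volume S ≠ ∞ :=
        ne_top_of_le_ne_top (hbox_ne m) (measure_mono fun θ' hθ' => hθ'.1)
      have hB₁ :
          volume (Icc (-π) π ×ˢ S) ≤ ENNReal.ofReal (2 * π) * ENNReal.ofReal (Cm * r ^ cm) := by
        rw [Measure.volume_eq_prod, Measure.prod_prod, Real.volume_Icc, sub_neg_eq_add, ← two_mul]
        gcongr
        exact (ENNReal.le_ofReal_iff_toReal_le hSfin (by positivity)).2 hIH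
      -- (ii) the fibred part: measurability
      have hBmeas : MeasurableSet B := by
        have hQ : Continuous fun p : ℝ × (Fin m → ℝ) => q (i.insertNth p.1 p.2) :=
          hq.comp (Continuous.finInsertNth i continuous_fst continuous_snd)
        have hR2 : Continuous fun p : ℝ × (Fin m → ℝ) => q (i.insertNth (θ₀ i) p.2) :=
          hRcont.comp continuous_snd
        exact (measurableSet_Icc.preimage measurable_fst).inter
          ((measurableSet_Icc.preimage measurable_snd).inter
            ((measurableSet_lt measurable_const hR2.measurable).inter
              (measurableSet_le hQ.measurable measurable_const)))
      -- (ii) the fibred part: each `t`-fibre is a one-dimensional small ball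
      have hsec : ∀ θ' : Fin m → ℝ, volume ((fun t : ℝ => (t, θ')) ⁻¹' B) ≤
          (Icc (fun _ : Fin m => -π) (fun _ => π)).indicator (fun _ => K) θ' := by
        intro θ'
        by_cases hθ' : θ' ∈ Icc (fun _ : Fin m => -π) (fun _ => π)
        · rw [Set.indicator_of_mem hθ']
          by_cases hlt : r * q θ₀ < q (i.insertNth (θ₀ i) θ')
          · obtain ⟨a, ha⟩ := hband (i.insertNth (θ₀ i) θ') i
            have hga : ∃ a : ℤ → ℂ, ∀ t : ℝ, ((q (i.insertNth t θ') : ℝ) : ℂ) =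
                ∑ k ∈ Finset.Icc (-(D : ℤ)) D, a k * Complex.exp ((k : ℂ) * (t : ℂ) * Complex.I) :=
              ⟨a, fun t => by rw [← ha t, Fin.update_insertNth]⟩
            have hg0 : ∀ t, 0 ≤ q (i.insertNth t θ') := fun t => hq0 _
            have hNik := hN D (fun t => q (i.insertNth t θ')) hga hg0 (θ₀ i)
            have hIpos : 0 < ∫ t in Icc (-π) π, q (i.insertNth t θ') := by
              have h1 : 0 < (2 * (D : ℝ) + 1) *
                  ((∫ t in Icc (-π) π, q (i.insertNth t θ')) / (2 * π)) :=
                lt_of_lt_of_le (lt_trans (mul_pos hr0 hqθ₀) hlt) hNik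
              exact (div_pos_iff_of_pos_right (by positivity)).1
                (pos_of_mul_pos_right h1 (by positivity))
            have hε : 0 < (2 * (D : ℝ) + 1) * r := by positivity
            calc volume ((fun t : ℝ => (t, θ')) ⁻¹' B)
                ≤ volume {t ∈ Icc (-π) π | q (i.insertNth t θ') ≤ ((2 * D + 1) * r) *
                    ((∫ u in Icc (-π) π, q (i.insertNth u θ')) / (2 * π))} := by
                  refine measure_mono fun t ht => ?_
                  have ht' : t ∈ Icc (-π) π ∧ θ' ∈ Icc (fun _ : Fin m => -π) (fun _ => π) ∧
                      r * q θ₀ < q (i.insertNth (θ₀ i) θ') ∧ q (i.insertNth t θ') ≤ η * q θ₀ := ht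
                  refine ⟨ht'.1, ?_⟩
                  calc q (i.insertNth t θ') ≤ η * q θ₀ := ht'.2.2.2
                    _ = r * (r * q θ₀) := by rw [← mul_assoc, hrr]
                    _ ≤ r * ((2 * D + 1) * ((∫ u in Icc (-π) π, q (i.insertNth u θ')) / (2 * π))) :=
                        mul_le_mul_of_nonneg_left (hlt.le.trans hNik) hr0.le
                    _ = ((2 * D + 1) * r) *
                        ((∫ u in Icc (-π) π, q (i.insertNth u θ')) / (2 * π)) := by ring
              _ ≤ K := hSB₁ (fun t => q (i.insertNth t θ')) hga hg0 hIpos _ hε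
          · have hemp : (fun t : ℝ => (t, θ')) ⁻¹' B ⊆ ∅ := fun t ht =>
              hlt (ht : t ∈ Icc (-π) π ∧ θ' ∈ Icc (fun _ : Fin m => -π) (fun _ => π) ∧
                r * q θ₀ < q (i.insertNth (θ₀ i) θ') ∧ q (i.insertNth t θ') ≤ η * q θ₀).2.2.1
            exact (measure_mono hemp).trans (by simp)
        · rw [Set.indicator_of_notMem hθ']
          have hemp : (fun t : ℝ => (t, θ')) ⁻¹' B ⊆ ∅ := fun t ht =>
            hθ' (ht : t ∈ Icc (-π) π ∧ θ' ∈ Icc (fun _ : Fin m => -π) (fun _ => π) ∧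
              r * q θ₀ < q (i.insertNth (θ₀ i) θ') ∧ q (i.insertNth t θ') ≤ η * q θ₀).2.1
          exact (measure_mono hemp).trans (by simp)
      have hB₂ : volume B ≤ K * ENNReal.ofReal (2 * π) ^ m := by
        rw [Measure.volume_eq_prod, Measure.prod_apply_symm hBmeas]
        calc ∫⁻ θ', volume ((fun t : ℝ => (t, θ')) ⁻¹' B)
            ≤ ∫⁻ θ', (Icc (fun _ : Fin m => -π) (fun _ => π)).indicator (fun _ => K) θ' :=
              lintegral_mono hsec
          _ = K * volume (Icc (fun _ : Fin m => -π) (fun _ => π)) :=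
              lintegral_indicator_const measurableSet_Icc K
          _ = K * ENNReal.ofReal (2 * π) ^ m := by rw [hbox]
      -- (iii) assembling
      have hvolA : volume A ≤ ENNReal.ofReal (2 * π) * ENNReal.ofReal (Cm * r ^ cm) +
          K * ENNReal.ofReal (2 * π) ^ m :=
        calc volume A
            = volume ((MeasurableEquiv.piFinSuccAbove (fun _ : Fin (m + 1) => ℝ) i).symm ⁻¹' A) :=
              ((volume_preserving_piFinSuccAbove (fun _ : Fin (m + 1) => ℝ)
                i).symm.measure_preimage_equiv A).symm
          _ ≤ volume (Icc (-π) π ×ˢ S ∪ B) := measure_mono hsub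
          _ ≤ volume (Icc (-π) π ×ˢ S) + volume B := measure_union_le _ _
          _ ≤ _ := add_le_add hB₁ hB₂
      have hAreal : (volume A).toReal ≤
          2 * π * (Cm * r ^ cm) + C₁ * ((2 * D + 1) * r) ^ c₁ * (2 * π) ^ m := by
        refine ENNReal.toReal_le_of_le_ofReal (by positivity) ?_
        rw [ENNReal.ofReal_add (by positivity) (by positivity),
          ENNReal.ofReal_mul (p := 2 * π) (by positivity),
          ENNReal.ofReal_mul (p := C₁ * ((2 * D + 1) * r) ^ c₁) (by positivity),
          ENNReal.ofReal_pow (p := 2 * π) (by positivity)]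
        exact hvolA
      calc (volume A).toReal
          ≤ 2 * π * (Cm * r ^ cm) + C₁ * ((2 * D + 1) * r) ^ c₁ * (2 * π) ^ m := hAreal
        _ ≤ 2 * π * (Cm * η ^ (min cm c₁ / 2)) +
            C₁ * ((2 * D + 1) ^ c₁ * η ^ (min cm c₁ / 2)) * (2 * π) ^ m := by
          have h1 : r ^ cm ≤ η ^ (min cm c₁ / 2) := hpow cm (min_le_left _ _)
          have h2 : ((2 * D + 1) * r) ^ c₁ ≤ (2 * D + 1) ^ c₁ * η ^ (min cm c₁ / 2) := by
            rw [Real.mul_rpow (by positivity) hr0.le]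
            exact mul_le_mul_of_nonneg_left (hpow c₁ (min_le_right _ _)) (by positivity)
          gcongr
        _ = (2 * π * Cm + C₁ * (2 * D + 1) ^ c₁ * (2 * π) ^ m) * η ^ (min cm c₁ / 2) := by ring
  -- the wrapper: `η ≤ 1` from `hmain`, `η > 1` from the trivial bound `(2π)^m`
  obtain ⟨C, c, hC, hc, h⟩ := hmain m
  refine ⟨C + (2 * π) ^ m, c, by positivity, hc, ?_⟩
  intro q hq hq0 hband θ₀ hqθ₀ η hη
  rcases le_or_gt η 1 with hη1 | hη1
  · calc (volume {θ ∈ Icc (fun _ : Fin m => -π) (fun _ => π) | q θ ≤ η * q θ₀}).toReal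
        ≤ C * η ^ c := h q hq hq0 hband θ₀ hqθ₀ η hη hη1
      _ ≤ (C + (2 * π) ^ m) * η ^ c := by gcongr; exact le_add_of_nonneg_right (by positivity)
  · calc (volume {θ ∈ Icc (fun _ : Fin m => -π) (fun _ => π) | q θ ≤ η * q θ₀}).toReal
        ≤ (volume (Icc (fun _ : Fin m => -π) (fun _ => π))).toReal :=
          ENNReal.toReal_mono (hbox_ne m) (measure_mono fun θ hθ => hθ.1)
      _ = (2 * π) ^ m := by
          rw [hbox, ENNReal.toReal_pow, ENNReal.toReal_ofReal (by positivity)]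
      _ ≤ (C + (2 * π) ^ m) * 1 := by linarith
      _ ≤ (C + (2 * π) ^ m) * η ^ c := by
          gcongr
          exact Real.one_le_rpow hη1.le hc.le

end Summit.QuantumFields.QCD.Theorems.CircleTransport
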